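import Mathlib
import Literature.Computability.AlgebraicComplexity.LRPencilOfMatrix
import Literature.Computability.AlgebraicComplexity.LandsbergRessayreNormalForm
import Literature.Computability.AlgebraicComplexity.DetReprEquivalent
import Literature.Computability.AlgebraicComplexity.VonZurGathenSingPermHeight
import Literature.Computability.AlgebraicComplexity.StandardFamiliesProofs
import Literature.Computability.AlgebraicComplexity.PermanentVsDeterminantProofs
import Literature.Computability.AlgebraicComplexity.DeterminantalComplexityProofs
import Summits.ValiantsHypothesis.ValiantsHypothesis.Theses.FreeSubtorus
import Summits.ValiantsHypothesis.ValiantsHypothesis.Theorems.FreeSubtorusOrbitDimensionBoundSlices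
import Summits.ValiantsHypothesis.ValiantsHypothesis.Theorems.FreeSubtorusOrbitDimensionBoundSliceRank
import Summits.ValiantsHypothesis.ValiantsHypothesis.Theorems.FreeSubtorusOrbitDimensionBoundStubHomothetyGraded
import Summits.ValiantsHypothesis.ValiantsHypothesis.Theorems.FreeSubtorusOrbitDimensionBoundStubGradedElimination
import Summits.ValiantsHypothesis.ValiantsHypothesis.Theorems.FreeSubtorusOrbitDimensionBoundStubPartialPermDiag
import Summits.ValiantsHypothesis.ValiantsHypothesis.Theorems.FreeSubtorusOrbitDimensionBoundStubLayerDecomposition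

/-!
# Crux `FreeSubtorus.OrbitDimensionBound` (stmt-ValiantsHypothesis-16133), line `Sketch`, §6 —
# the homothety–strength bound and the crux at `n = 4`

**What is proved.**  The crux forces, at every size `m ≥ dc(per_n)`, an affine determinantal
representation of `per_n` with exact `GL_m × GL_m` lifts of all homotheties `x ↦ c·x` (landed
`homothetyLifts_of_orbitDimensionBound`; homotheties lie in every admissible `T_Λ`).  This file turns
homothety lifts into restricted-strength decompositions — the pencil form of
Gesmundo–Ghosal–Ikenmeyer–Lysikov's Theorem 12 ("a homogeneous ABP for `F` has at least
`Σ_j str_j(F)` vertices"):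

* `gradedNormalForm`: a DEGREE-GRADED representation of `per_n` (`n ≥ 3`; potentials `a, b` with
  constants only where `a i + b j = 0`, variables only where `a i + b j = 1` — produced from the
  lifts by `stub_homothetyGraded`, p173866) is gauge-equivalent to a degree-graded one whose
  constant part is `diag(1, …, 1)` with a single `0` (von zur Gathen regularity `rank = m - 1`,
  graded Gaussian elimination `stub_gradedElimination` p173965, partial permutation matrices
  `stub_partialPermDiag` p173840, row/column permutations and one row rescaling);
* `homothetyStrengthBound`: hence integer levels `a` and an index `i₀` such that for every
  `1 ≤ λ ≤ n - 1`, `per_n = Σ_j g_j h_j` with `g_j` homogeneous of degree `λ` and supported on the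
  level `a j = a i₀ - λ` (`stub_layerDecomposition`: `per_n = (-1)^{n-1} uᵀ N^{n-2} v` for the
  bordered unipotent pencil, cut after `λ` factors);
* `orbitDimensionBound_strength_four`: at `n = 4` the three levels are disjoint, avoid `i₀`, and the
  two end levels have `≥ 4` members each by `sr(per_4) = 4` (`sliceRank_perPoly`, p173396; at the
  sink through the degree-1 components of the cofactors), so the crux yields from EVERY size-`m`
  representation of `per_4` a 2-restricted decomposition `per_4 = Σ_{t<w} G_t H_t` (`G_t`
  quadrics) with `w + 9 ≤ m`;
* `orbitDimensionBound_dc_four`: **`OrbitDimensionBound ∧ str_2(per_4) ≥ 6 ⇒ dc(per_4) = 15`** —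
  the crux at `n = 4` is exactly Grenet optimality as soon as the two-row Laplace expansion
  (six products of `2 × 2` permanents) is optimal among quadratic expansions of `per_4`.  For
  `det_4` the analogous number is `3` (`det_4 = P₁₂P₃₄ - P₁₃P₂₄ + P₁₄P₂₃`, the Pfaffian of
  `A E Aᵀ`); numerically the `2|2` partition rank of the `per_4` tensor is `6` with BORDER rank `≤ 5`
  (lead c2 evidence `str2-probe.md` on the item).
-/

-- Sub = Summit single-conjunct layout: the duplicated namespace component is mandated by the tree.
set_option linter.dupNamespace false

noncomputable section

namespace Summit.ValiantsHypothesis.ValiantsHypothesis.Theorems.FreeSubtorusOrbitDimensionBound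

open Matrix MvPolynomial Finset
open Literature.Computability.AlgebraicComplexity LRPencil


/-- **Graded normal form** (lead, from `stub_gradedElimination` + `stub_partialPermDiag` +
von zur Gathen regularity).  A degree-graded affine representation of `per_n` (`n ≥ 3`) is
gauge-equivalent (graded constant gauge, row/column permutations, one row rescaling) to a
degree-graded representation whose constant part is `diag(1, …, 1)` with a single `0`. [folklore] -/
theorem gradedNormalForm (n m : ℕ) (hn : 3 ≤ n)
    (B : Matrix (Fin m) (Fin m) (MvPolynomial (Fin n × Fin n) ℂ)) (a b : Fin m → ℤ)
    (hB : Literature.Computability.AlgebraicComplexity.IsAffineDetRepr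
      (Literature.Computability.AlgebraicComplexity.perPoly (Fin n) ℂ) B)
    (h0 : ∀ i j, Literature.Computability.AlgebraicComplexity.constPart B i j ≠ 0 → a i + b j = 0)
    (h1 : ∀ i j (v : Fin n × Fin n),
      Literature.Computability.AlgebraicComplexity.LRPencil.coeffMat B v i j ≠ 0 → a i + b j = 1) :
    ∃ (B' : Matrix (Fin m) (Fin m) (MvPolynomial (Fin n × Fin n) ℂ)) (a' b' : Fin m → ℤ) (i₀ : Fin m),
      Literature.Computability.AlgebraicComplexity.IsAffineDetRepr
        (Literature.Computability.AlgebraicComplexity.perPoly (Fin n) ℂ) B' ∧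
      (∀ i j, Literature.Computability.AlgebraicComplexity.constPart B' i j ≠ 0 → a' i + b' j = 0) ∧
      (∀ i j (v : Fin n × Fin n),
        Literature.Computability.AlgebraicComplexity.LRPencil.coeffMat B' v i j ≠ 0 → a' i + b' j = 1) ∧
      (∀ i j, Literature.Computability.AlgebraicComplexity.constPart B' i j =
        if i = j ∧ i ≠ i₀ then 1 else 0) := by
  classical
  set X₀ := Literature.Computability.AlgebraicComplexity.constPart B with hX₀
  -- graded elimination of the constant part (weights `a` on rows, `-b` on columns)
  obtain ⟨P, Q, hP, hQ, hPg, hQg, h01, hrow, hcol⟩ :=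
    stub_gradedElimination a (fun j => -b j) X₀ (fun i j hij => by have := h0 i j hij; omega)
  -- regularity: `rank X₀ = m - 1`, preserved by the invertible `P, Q`
  have hreg := (isRegularDetRepr_perPoly vonzurGathen1987_perm_detRepr_rank_holds hn hB).2
  have hPdet : IsUnit P.det := (Matrix.isUnit_iff_isUnit_det P).1 hP
  have hQdet : IsUnit Q.det := (Matrix.isUnit_iff_isUnit_det Q).1 hQ
  have hrank : (P * X₀ * Q).rank = m - 1 := by
    rw [Matrix.rank_mul_eq_left_of_isUnit_det Q _ hQdet, Matrix.rank_mul_eq_right_of_isUnit_det P _ hPdet]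
    exact hreg
  -- `m ≥ 1` (a `0 × 0` determinant is `1 ≠ per_n`)
  have hm : 1 ≤ m := by
    rcases Nat.eq_zero_or_pos m with rfl | h
    · exfalso
      have hdet := hB.2
      rw [Matrix.det_isEmpty] at hdet
      have h3 := totalDegree_perPoly_holds (n := Fin n) (k := ℂ)
      rw [← hdet, totalDegree_one, Fintype.card_fin] at h3
      omega
    · exact h
  obtain ⟨ρ, κ, i₀, hY⟩ := stub_partialPermDiag (P * X₀ * Q) h01 hrow hcol (by omega)
  -- the gauged, permuted representation and the correcting constant
  set B₁ : Matrix (Fin m) (Fin m) (MvPolynomial (Fin n × Fin n) ℂ) := P.map C * B * Q.map C with hB₁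
  set B₂ : Matrix (Fin m) (Fin m) (MvPolynomial (Fin n × Fin n) ℂ) := B₁.submatrix ρ κ with hB₂
  set c : ℂ := (Equiv.Perm.sign ρ : ℂ) * (Equiv.Perm.sign κ : ℂ) * (P.det * Q.det) with hc
  have hc0 : c ≠ 0 := by
    have h1' : ((Equiv.Perm.sign ρ : ℤ) : ℂ) ≠ 0 := by
      rcases Int.units_eq_one_or (Equiv.Perm.sign ρ) with h | h <;> simp [h]
    have h2' : ((Equiv.Perm.sign κ : ℤ) : ℂ) ≠ 0 := by
      rcases Int.units_eq_one_or (Equiv.Perm.sign κ) with h | h <;> simp [h]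
    exact mul_ne_zero (mul_ne_zero h1' h2') (mul_ne_zero hPdet.ne_zero hQdet.ne_zero)
  have hdetB₂ : B₂.det = C c * Literature.Computability.AlgebraicComplexity.perPoly (Fin n) ℂ := by
    have e1 : B₂ = (B₁.submatrix id κ).submatrix ρ id := by
      ext i j; simp [hB₂, Matrix.submatrix_apply]
    rw [e1, Matrix.det_permute, Matrix.det_permute', hB₁, det_map_C_mul_mul_map_C, hB.2, hc]
    simp only [map_mul]
    have hs : ∀ τ : Equiv.Perm (Fin m), ((Equiv.Perm.sign τ : ℤ) : MvPolynomial (Fin n × Fin n) ℂ) =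
        C ((Equiv.Perm.sign τ : ℤ) : ℂ) := fun τ => by simp
    rw [hs ρ, hs κ]; ring
  set d : Fin m → ℂ := fun i => if i = i₀ then c⁻¹ else 1 with hd
  set B' : Matrix (Fin m) (Fin m) (MvPolynomial (Fin n × Fin n) ℂ) :=
    (Matrix.diagonal d).map C * B₂ with hB'
  have hB'ap : ∀ i j, B' i j = C (d i) * B₂ i j := by
    intro i j
    simp only [hB', Matrix.mul_apply, Matrix.map_apply, Matrix.diagonal_apply]
    rw [Finset.sum_eq_single i]
    · simp
    · intro k _ hk; simp [Ne.symm hk]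
    · simp
  refine ⟨B', fun i => a (ρ i), fun j => b (κ j), i₀, ⟨?_, ?_⟩, ?_, ?_, ?_⟩
  · -- affine entries
    intro i j
    rw [hB'ap]
    refine (totalDegree_mul _ _).trans ?_
    rw [totalDegree_C, zero_add, hB₂, Matrix.submatrix_apply, hB₁]
    exact totalDegree_map_C_mul_mul_map_C_le P Q hB.1 _ _
  · -- determinant
    have e2 : B' = B₂.updateRow i₀ ((C c⁻¹ : MvPolynomial (Fin n × Fin n) ℂ) • B₂ i₀) := by
      ext i j
      rw [hB'ap, Matrix.updateRow_apply]
      by_cases hi : i = i₀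
      · subst hi; simp [hd]
      · simp [hd, hi]
    rw [e2, Matrix.det_updateRow_smul, Matrix.updateRow_eq_self, hdetB₂, ← mul_assoc, ← map_mul,
      inv_mul_cancel₀ hc0, map_one, one_mul]
  · -- constants are graded
    intro i j hij
    rw [Literature.Computability.AlgebraicComplexity.constPart_apply, hB'ap, map_mul,
      constantCoeff_C] at hij
    have hij' : constantCoeff (B₂ i j) ≠ 0 := right_ne_zero_of_mul hij
    rw [hB₂, Matrix.submatrix_apply, ← Literature.Computability.AlgebraicComplexity.constPart_apply,
      hB₁, constPart_mul, constPart_map_C, constPart_mul, constPart_map_C, ← hX₀] at hij'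
    -- `(P X₀ Q) (ρ i) (κ j) ≠ 0`: unfold the two products
    rw [Matrix.mul_apply] at hij'
    obtain ⟨j', _, hj'⟩ := Finset.exists_ne_zero_of_sum_ne_zero hij'
    have hQ' : Q j' (κ j) ≠ 0 := right_ne_zero_of_mul hj'
    have hPX : (P * X₀) (ρ i) j' ≠ 0 := left_ne_zero_of_mul hj'
    rw [Matrix.mul_apply] at hPX
    obtain ⟨i', _, hi'⟩ := Finset.exists_ne_zero_of_sum_ne_zero hPX
    have h := h0 i' j' (right_ne_zero_of_mul hi')
    have hp := hPg _ _ (left_ne_zero_of_mul hi')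
    have hq : -b j' = -b (κ j) := hQg _ _ hQ'
    show a (ρ i) + b (κ j) = 0
    omega
  · -- variables are graded
    intro i j v hij
    rw [Literature.Computability.AlgebraicComplexity.LRPencil.coeffMat_apply, hB'ap, coeff_C_mul] at hij
    have hij' : coeff (Finsupp.single v 1) (B₂ i j) ≠ 0 := right_ne_zero_of_mul hij
    rw [hB₂, Matrix.submatrix_apply, ← Literature.Computability.AlgebraicComplexity.LRPencil.coeffMat_apply,
      hB₁, coeffMat_C_mul_mul_C, Matrix.mul_apply] at hij'
    obtain ⟨j', _, hj'⟩ := Finset.exists_ne_zero_of_sum_ne_zero hij'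
    have hQ' : Q j' (κ j) ≠ 0 := right_ne_zero_of_mul hj'
    have hPX : (P * Literature.Computability.AlgebraicComplexity.LRPencil.coeffMat B v) (ρ i) j' ≠ 0 :=
      left_ne_zero_of_mul hj'
    rw [Matrix.mul_apply] at hPX
    obtain ⟨i', _, hi'⟩ := Finset.exists_ne_zero_of_sum_ne_zero hPX
    have h := h1 i' j' v (right_ne_zero_of_mul hi')
    have hp := hPg _ _ (left_ne_zero_of_mul hi')
    have hq : -b j' = -b (κ j) := hQg _ _ hQ'
    show a (ρ i) + b (κ j) = 1
    omega
  · -- the constant part is `diag` with a hole at `i₀`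
    intro i j
    rw [Literature.Computability.AlgebraicComplexity.constPart_apply, hB'ap, map_mul, constantCoeff_C,
      hB₂, Matrix.submatrix_apply, ← Literature.Computability.AlgebraicComplexity.constPart_apply, hB₁,
      constPart_mul, constPart_map_C, constPart_mul, constPart_map_C, ← hX₀, hY i j]
    by_cases hi : i = i₀
    · subst hi; simp [hd]
    · simp [hd, hi]


/-- **The homothety–strength bound** (lead, from the four stubs of reshape 6): exact lifts of all
homotheties on an affine representation of `per_n` (`n ≥ 3`) of size `m` give integer levels
`a : Fin m → ℤ` and a distinguished index `i₀` such that for every `1 ≤ λ ≤ n - 1`,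
`per_n = Σ_j g_j h_j` with `g_j` homogeneous of degree `λ` and supported on the level
`a j = a i₀ - λ`.  Pencil form of GGIL22 Thm. 12. [cite: GesmundoGhosalIkenmeyerLysikov2022, Thm. 12] -/
theorem homothetyStrengthBound (n m : ℕ) (hn : 3 ≤ n)
    (B : Matrix (Fin m) (Fin m) (MvPolynomial (Fin n × Fin n) ℂ))
    (hB : Literature.Computability.AlgebraicComplexity.IsAffineDetRepr
      (Literature.Computability.AlgebraicComplexity.perPoly (Fin n) ℂ) B)
    (hlift : ∀ (c : ℂˣ) (γ : GL (Fin n × Fin n) ℂ),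
        (γ : Matrix (Fin n × Fin n) (Fin n × Fin n) ℂ) = Matrix.diagonal (fun _ => (c : ℂ)) →
        ∃ g h : GL (Fin m) ℂ,
          Literature.Computability.AlgebraicComplexity.Matrix.linSubstEntries γ B =
            (g : Matrix (Fin m) (Fin m) ℂ).map MvPolynomial.C * B *
              ((h⁻¹ : GL (Fin m) ℂ) : Matrix (Fin m) (Fin m) ℂ).map MvPolynomial.C) :
    ∃ (a : Fin m → ℤ) (i₀ : Fin m), ∀ l : ℕ, 1 ≤ l → l + 1 ≤ n →
      ∃ g h : Fin m → MvPolynomial (Fin n × Fin n) ℂ,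
        (∀ j, (g j).IsHomogeneous l) ∧ (∀ j, g j ≠ 0 → a j + (l : ℤ) = a i₀) ∧
        Literature.Computability.AlgebraicComplexity.perPoly (Fin n) ℂ = ∑ j, g j * h j := by
  obtain ⟨B₁, a₁, b₁, hB₁, h0, h1⟩ := stub_homothetyGraded n m B hB hlift
  obtain ⟨B₂, a₂, b₂, i₀, hB₂, h0', h1', hdiag⟩ := gradedNormalForm n m hn B₁ a₁ b₁ hB₁ h0 h1
  exact ⟨a₂, i₀, fun l hl hln => stub_layerDecomposition n m (by omega) B₂ a₂ b₂ i₀ hB₂ h0' h1' hdiag l hl hln⟩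

/-- Reindexing a decomposition supported on a finset: if `per = Σ_j g_j h_j` and `g_j = 0` off
`S`, then `per = Σ_{t : Fin |S|} g (e t) h (e t)` for the enumeration `e` of `S`. [folklore] -/
theorem sum_restrict_equivFin {n m : ℕ} (g h : Fin m → MvPolynomial (Fin n × Fin n) ℂ)
    (S : Finset (Fin m)) (hS : ∀ j, j ∉ S → g j = 0)
    (hsum : Literature.Computability.AlgebraicComplexity.perPoly (Fin n) ℂ = ∑ j, g j * h j) :
    Literature.Computability.AlgebraicComplexity.perPoly (Fin n) ℂ =
      ∑ t : Fin S.card, g ((S.equivFin.symm t : S) : Fin m) * h ((S.equivFin.symm t : S) : Fin m) := by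
  rw [hsum, ← Finset.sum_subset (Finset.subset_univ S)
    (fun j _ hj => by rw [hS j hj, zero_mul])]
  rw [← Finset.sum_coe_sort S]
  exact (Fintype.sum_equiv S.equivFin.symm _ _ (fun t => rfl)).symm

/-- Degree bookkeeping: if `per_n = Σ g_j h_j` with `g_j` homogeneous of degree `n - 1`, the
degree-`1` components of the `h_j` already suffice. [folklore] -/
theorem perPoly_eq_sum_mul_homogeneousComponent_one {n m : ℕ} (hn : 1 ≤ n)
    (g h : Fin m → MvPolynomial (Fin n × Fin n) ℂ) (hg : ∀ j, (g j).IsHomogeneous (n - 1))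
    (hsum : Literature.Computability.AlgebraicComplexity.perPoly (Fin n) ℂ = ∑ j, g j * h j) :
    Literature.Computability.AlgebraicComplexity.perPoly (Fin n) ℂ =
      ∑ j, MvPolynomial.homogeneousComponent 1 (h j) * g j := by
  classical
  have hper : (Literature.Computability.AlgebraicComplexity.perPoly (Fin n) ℂ).IsHomogeneous n := by
    simpa using (Literature.Computability.AlgebraicComplexity.perPoly_isHomogeneous (n := Fin n) (k := ℂ))
  have key : ∀ j, MvPolynomial.homogeneousComponent n (g j * h j) =
      MvPolynomial.homogeneousComponent 1 (h j) * g j := by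
    intro j
    conv_lhs => rw [← MvPolynomial.sum_homogeneousComponent (h j), Finset.mul_sum, map_sum]
    have hterm : ∀ i, MvPolynomial.homogeneousComponent n (g j * MvPolynomial.homogeneousComponent i (h j)) =
        if n = n - 1 + i then g j * MvPolynomial.homogeneousComponent i (h j) else 0 := fun i =>
      MvPolynomial.homogeneousComponent_of_mem
        ((hg j).mul (MvPolynomial.homogeneousComponent_isHomogeneous i (h j)))
    simp only [hterm]
    rw [Finset.sum_ite, Finset.sum_const_zero, add_zero]
    by_cases hmem : 1 ∈ Finset.range ((h j).totalDegree + 1)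
    · have : (Finset.range ((h j).totalDegree + 1)).filter (fun i => n = n - 1 + i) = {1} := by
        ext i; simp only [Finset.mem_filter, Finset.mem_singleton]
        constructor
        · rintro ⟨-, hi⟩; omega
        · rintro rfl; exact ⟨hmem, by omega⟩
      rw [this, Finset.sum_singleton, mul_comm]
    · have : (Finset.range ((h j).totalDegree + 1)).filter (fun i => n = n - 1 + i) = ∅ := by
        ext i; simp only [Finset.mem_filter, Finset.notMem_empty, iff_false, not_and]
        intro hi h'; have : i = 1 := by omega
        subst this; exact hmem hi
      rw [this, Finset.sum_empty]
      have h0 : MvPolynomial.homogeneousComponent 1 (h j) = 0 := by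
        apply MvPolynomial.homogeneousComponent_eq_zero
        simp only [Finset.mem_range, not_lt] at hmem; omega
      rw [h0, zero_mul]
  calc Literature.Computability.AlgebraicComplexity.perPoly (Fin n) ℂ
      = MvPolynomial.homogeneousComponent n (Literature.Computability.AlgebraicComplexity.perPoly (Fin n) ℂ) :=
        (MvPolynomial.homogeneousComponent_eq_self hper).symm
    _ = ∑ j, MvPolynomial.homogeneousComponent n (g j * h j) := by rw [hsum, map_sum]
    _ = ∑ j, MvPolynomial.homogeneousComponent 1 (h j) * g j := Finset.sum_congr rfl fun j _ => key j

/-- **The crux at `n = 4`, pinned to one number.**  `OrbitDimensionBound` forces every affine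
determinantal representation of `per_4` of size `m` to come with a 2-restricted decomposition
`per_4 = Σ_{t<w} g_t h_t` (`g_t` quadrics) with `w + 9 ≤ m`: homothety lifts (landed
`homothetyLifts_of_orbitDimensionBound`), the homothety–strength bound, `sr(per_4) = 4` at both
ends (§5) and the disjointness of the three levels.  Hence `crux ∧ dc(per_4) ≤ 14 ⇒ str_2(per_4) ≤ 5`.
[cite: GesmundoGhosalIkenmeyerLysikov2022, Thm. 12] -/
theorem orbitDimensionBound_strength_four
    (hcrux : Summit.ValiantsHypothesis.ValiantsHypothesis.Theses.FreeSubtorus.OrbitDimensionBound) :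
    ∀ (m : ℕ) (A : Matrix (Fin m) (Fin m) (MvPolynomial (Fin 4 × Fin 4) ℂ)),
      Literature.Computability.AlgebraicComplexity.IsAffineDetRepr
        (Literature.Computability.AlgebraicComplexity.perPoly (Fin 4) ℂ) A →
      ∃ (w : ℕ) (g h : Fin w → MvPolynomial (Fin 4 × Fin 4) ℂ),
        w + 9 ≤ m ∧ (∀ t, (g t).IsHomogeneous 2) ∧
        Literature.Computability.AlgebraicComplexity.perPoly (Fin 4) ℂ = ∑ t, g t * h t := by
  classical
  intro m A hA
  obtain ⟨B, hB, hlift⟩ := homothetyLifts_of_orbitDimensionBound hcrux 4 (by norm_num) m A hA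
  obtain ⟨a, i₀, H⟩ := homothetyStrengthBound 4 m (by norm_num) B hB hlift
  obtain ⟨g₁, h₁, hg₁, hl₁, hs₁⟩ := H 1 le_rfl (by norm_num)
  obtain ⟨g₂, h₂, hg₂, hl₂, hs₂⟩ := H 2 (by norm_num) (by norm_num)
  obtain ⟨g₃, h₃, hg₃, hl₃, hs₃⟩ := H 3 (by norm_num) (by norm_num)
  -- the three levels
  set S : ℕ → Finset (Fin 4 |> fun _ => Fin m) := fun l => Finset.univ.filter (fun j : Fin m => a j + (l : ℤ) = a i₀) with hSdef
  have hS : ∀ (l : ℕ) (g : Fin m → MvPolynomial (Fin 4 × Fin 4) ℂ),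
      (∀ j, g j ≠ 0 → a j + (l : ℤ) = a i₀) → ∀ j, j ∉ S l → g j = 0 := by
    intro l g hl j hj
    by_contra hne
    exact hj (by simp [hSdef, hl j hne])
  -- level 1 has ≥ 4 members (slice rank at the source)
  have h4₁ : 4 ≤ (S 1).card :=
    sliceRank_perPoly 4 _ _ _ (fun t => hg₁ _) (sum_restrict_equivFin g₁ h₁ (S 1) (hS 1 g₁ hl₁) hs₁)
  -- level 3 has ≥ 4 members (slice rank at the sink: degree-1 parts of the cofactors)
  have h4₃ : 4 ≤ (S 3).card := by
    have hs₃' := perPoly_eq_sum_mul_homogeneousComponent_one (n := 4) (by norm_num) g₃ h₃ hg₃ hs₃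
    have hs₃'' := sum_restrict_equivFin (fun j => MvPolynomial.homogeneousComponent 1 (h₃ j) * g₃ j)
      (fun _ => (1 : MvPolynomial (Fin 4 × Fin 4) ℂ)) (S 3)
      (fun j hj => by rw [hS 3 g₃ hl₃ j hj, mul_zero]) (by simpa using hs₃')
    have hs₄ : Literature.Computability.AlgebraicComplexity.perPoly (Fin 4) ℂ =
        ∑ t : Fin (S 3).card, MvPolynomial.homogeneousComponent 1 (h₃ ((S 3).equivFin.symm t : Fin m)) *
          g₃ ((S 3).equivFin.symm t : Fin m) := by
      simpa [mul_one] using hs₃''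
    exact sliceRank_perPoly 4 _
      (fun t => MvPolynomial.homogeneousComponent 1 (h₃ ((S 3).equivFin.symm t : Fin m)))
      (fun t => g₃ ((S 3).equivFin.symm t : Fin m))
      (fun t => MvPolynomial.homogeneousComponent_isHomogeneous 1 _) hs₄
  -- the three levels are pairwise disjoint and avoid `i₀`
  have hdisj : ∀ l l' : ℕ, l ≠ l' → Disjoint (S l) (S l') := by
    intro l l' hll'
    rw [Finset.disjoint_left]
    intro j hj hj'
    simp only [hSdef, Finset.mem_filter, Finset.mem_univ, true_and] at hj hj'
    omega
  have hi₀ : ∀ l : ℕ, 1 ≤ l → i₀ ∉ S l := by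
    intro l hl h
    simp only [hSdef, Finset.mem_filter, Finset.mem_univ, true_and] at h
    omega
  have hcard : (S 1).card + (S 2).card + (S 3).card + 1 ≤ m := by
    have hu : (S 1 ∪ S 2 ∪ S 3 ∪ {i₀}).card ≤ m := by
      simpa using Finset.card_le_univ (S 1 ∪ S 2 ∪ S 3 ∪ {i₀})
    have e : (S 1 ∪ S 2 ∪ S 3 ∪ {i₀}).card = (S 1).card + (S 2).card + (S 3).card + 1 := by
      rw [Finset.card_union_of_disjoint, Finset.card_union_of_disjoint, Finset.card_union_of_disjoint,
        Finset.card_singleton]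
      · exact hdisj 1 2 (by norm_num)
      · rw [Finset.disjoint_union_left]; exact ⟨hdisj 1 3 (by norm_num), hdisj 2 3 (by norm_num)⟩
      · rw [Finset.disjoint_singleton_right]
        simp only [Finset.mem_union, not_or]
        exact ⟨⟨hi₀ 1 le_rfl, hi₀ 2 (by norm_num)⟩, hi₀ 3 (by norm_num)⟩
    omega
  -- the middle level is the 2-restricted decomposition
  refine ⟨(S 2).card, fun t => g₂ ((S 2).equivFin.symm t : Fin m), fun t => h₂ ((S 2).equivFin.symm t : Fin m),
    by omega, fun t => hg₂ _, sum_restrict_equivFin g₂ h₂ (S 2) (hS 2 g₂ hl₂) hs₂⟩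

/-- **Corollary: `crux ∧ str_2(per_4) ≥ 6 ⇒ dc(per_4) = 15`** — the crux at `n = 4` is exactly
Grenet optimality as soon as two-row Laplace expansion is optimal among quadratic expansions of
`per_4` (for `det_4` the analogous number is `3`). [cite: Grenet2011, Thm. 1] -/
theorem orbitDimensionBound_dc_four
    (hcrux : Summit.ValiantsHypothesis.ValiantsHypothesis.Theses.FreeSubtorus.OrbitDimensionBound)
    (hstr : ∀ (w : ℕ) (g h : Fin w → MvPolynomial (Fin 4 × Fin 4) ℂ), (∀ t, (g t).IsHomogeneous 2) →
      Literature.Computability.AlgebraicComplexity.perPoly (Fin 4) ℂ = ∑ t, g t * h t → 6 ≤ w) :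
    Literature.Computability.AlgebraicComplexity.determinantalComplexity
      (Literature.Computability.AlgebraicComplexity.perPoly (Fin 4) ℂ) = 15 := by
  apply le_antisymm
  · exact determinantalComplexity_perPoly_le_holds ℂ 4 (by norm_num)
  · obtain ⟨A, hA⟩ := hasDetRepr_determinantalComplexity_holds
      (Literature.Computability.AlgebraicComplexity.perPoly (Fin 4) ℂ)
    obtain ⟨w, g, h, hw, hg, hs⟩ := orbitDimensionBound_strength_four hcrux _ A hA
    have := hstr w g h hg hs
    omega

end Summit.ValiantsHypothesis.ValiantsHypothesis.Theorems.FreeSubtorusOrbitDimensionBound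

end
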